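import Literature.AlgebraicGeometry.HodgeTheory.WeilClassesLocalAnchor
import Literature.AlgebraicGeometry.HodgeTheory.WeilFamilyReach
import HarnessLib

/-!
# Weil anchors without hyperbolicity: the local clause, family reach, and "reached from a locally algebraic anchor"

Family `hodge`, layer `Literature/AlgebraicGeometry/HodgeTheory`. Requested by the B2b ladder `hodge-weil`
(packet `run/shared/lean/b2b/hodge-weil/`, `LADDER.md ## CARVER — v4`, C25–C27; `DIVERGENCE.md` D13), carver
generation 4. THREE PREDICATES (real definitions, verbatim sub-formulae of existing declarations) and three
definitional bridges; NOTHING is asserted (no named fact, no claim).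

The predicate `HasLocallyAlgebraicWeilAnchor n d` (`WeilClassesLocalAnchor.lean`) bundles (i) a HYPERBOLIC anchor
`(P, ψ₀, e, a)` with a non-zero rational Weil class `w` and (ii) a LOCAL CLAUSE at `(P, h_K, w)`; the named fact
`weilFamilyReach_hyperbolic` (`WeilFamilyReach.lean`) concludes with (iii) a REACH block: a Weil family from the
anchor reaching the target. Neither (ii) nor (iii) mentions hyperbolicity, the discriminant of the component, or
the Weil operator of the anchor. This file names them:

* `WeilAnchorLocalClause n d P h w` — clause (ii) with the anchor data `(P, h, w)` as parameters
  (`hasLocallyAlgebraicWeilAnchor_iff : HasLocallyAlgebraicWeilAnchor n d ↔ ∃ hyperbolic (P, ψ₀, e, a), ∃ w ≠ 0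
  rational in the Weil plane, WeilAnchorLocalClause n d P h_K w` is `Iff.rfl`).
* `WeilFamilyReaches n d P h w A φ` — block (iii) with the anchor's polarization class abstracted to `h`
  (`weilFamilyReaches_of_reach_hyperbolic`: the named fact supplies it between hyperbolic members, by direct
  application).
* `WeilReachedFromLocalAnchor n d A φ := ∃ (P, h, w), IsRationalClass w ∧ WeilAnchorLocalClause n d P h w ∧
  WeilFamilyReaches n d P h w A φ` — "the target `(A, φ)` is reached by a `√-d`-Weil family from SOME locally
  algebraic anchor". The anchor is quantified existentially PER TARGET, so the invariant indexing the target's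
  deformation component — `det H ∈ ℚˣ/N(Kˣ)` (Landherr 1936; van Geemen 1994, 5.2 (3), 5.3–5.4: rank,
  discriminant and signature classify the `K`-Hermitian form; Deligne 1982, proof of Thm. 4.8: the component of the
  PEL moduli space) — which the tree's real carriers do not have (the abstract `Motives.weilDiscriminant` is not
  connected to `complexBetti`), never has to be named. `weilReachedFromLocalAnchor_of_localAnchor_of_reach_hyperbolic`:
  on HYPERBOLIC targets it follows from `HasLocallyAlgebraicWeilAnchor n d ∧ weilFamilyReach_hyperbolic`.

Summit-side (`Summits/HodgeConjecture/HodgeConjecture/Theorems/WeilTypeLadderAnchorEngine.lean`, same seat) the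
ENGINE `IsRationalClass w ∧ WeilAnchorLocalClause ∧ WeilFamilyReaches ⟹ weilClassesOf A φ n d ≤ algebraicClasses`
is kernel-checked (it is the gen-3 proof of `weilClasses_algebraic_hyperbolic_of_localAnchor` with the two uses of
hyperbolicity moved to the caller), and `∀ targets, WeilReachedFromLocalAnchor` feeds the rungs R1′
(`NonsplitSixfolds`), R1 (`WeilSixfolds`, stmt-HodgeConjecture-2524) and R∞ (`WeilClassesImaginaryQuadratic`):
the "second door" to the sixfold rungs through NON-split anchors in dimension 6 (product points `X⁴ × S²`,
Schoen 1998 §10 / Markman 2509.23403 §11.5), next to the dimension-8 split anchor of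
`weilSixfolds_of_reach_of_localAnchor_four`.

These predicates are ENGINE INPUTS, not special cases of the summit statement: the family half of
`WeilReachedFromLocalAnchor` is a moduli statement (existence of Deligne's polarized PEL family through the
target's component) that the tree does not construct; its intended discharge is a reach fact per component
(refereed: Deligne / van Geemen / Landherr / Mumford–Fogarty–Kirwan / Milne, to be rendered once `det H` is on
carriers) plus ONE locally algebraic anchor per component (not known at present beyond the hyperbolic sixfold case).

## References

* [Deligne1982HodgeCycles] P. Deligne, Hodge cycles on abelian varieties, LNM 900 (1982), proof of Thm. 4.8
  (pp. 47–52), Prop. 4.4.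
* [vanGeemen1994HodgeAV] B. van Geemen, An introduction to the Hodge conjecture for abelian varieties, LNM 1594
  (1994), Lemma 5.2, 5.3–5.4, 5.8–5.11.
* [Landherr1936HermitianForms] W. Landherr, Abh. Math. Sem. Hamburg 11 (1936), Satz (classification of Hermitian
  forms over number fields by rank, discriminant, signatures).
* [Markman2025SecantWeil] E. Markman, arXiv:2502.03415 v2 (2025), §1.5, §7.4.2, proof of Thm. 1.5.1 (§9.3).
  UNREFEREED (only the SHAPE of the local clause is taken from it; nothing is asserted here).
* [BuchweitzFlenner2003] R.-O. Buchweitz, H. Flenner, Compositio Math. 137 (2003), Thm. 5.1 (the local shape).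
* [Schoen1998Addendum] C. Schoen, Addendum to: Hodge classes on self-products of a variety with an automorphism,
  Compositio Math. 114 (1998), §10 (product anchors `X × S`).
-/

noncomputable section

open CategoryTheory

namespace Literature.AlgebraicGeometry.HodgeTheory

open Literature.AlgebraicTopology.SingularHomology

section HodgeTheory

/-- **The local clause at an anchor `(P, h, w)`** (`h ∈ H²(P(ℂ); ℂ)`, `w ∈ H^{2n}(P(ℂ); ℂ)` arbitrary classes,
`K = ℚ(√-d)`): along EVERY smooth projective family `f : 𝒳 ⟶ S` of relative dimension `2n` (`𝒳`, `S`
quasi-projective, `S` smooth irreducible) all of whose fibres are abelian `2n`-folds with an endomorphism of square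
`-d`, for all global classes `H` (rational `(1,1)` on every fibre) and `W` (rational `(n,n)` on every fibre), every
point `s₀` and chart `e' : P.X ≅ 𝒳_{s₀}` with `e'^*(H|_{𝒳_{s₀}}) = h` and `e'^*(W|_{𝒳_{s₀}}) = w`, there are an OPEN
`U ∋ s₀` and `q ∈ ℚ` with `q·(H|_{𝒳_s})ⁿ + W|_{𝒳_s} ∈ algebraicClasses (𝒳_s) n` for all `s ∈ U`. VERBATIM the
last clause of `HasLocallyAlgebraicWeilAnchor n d` with the anchor data as parameters
(`hasLocallyAlgebraicWeilAnchor_iff`); the local output shape of a semiregularity theorem (Bloch (7.4),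
Buchweitz–Flenner Thm. 5.1, Markman Conj. 7.3.9 proved for abelian families in §7.4.2) at the anchor.
[cite: BuchweitzFlenner2003, Thm. 5.1] [cite: Markman2025SecantWeil, §1.5 and §7.4.2] -/
def WeilAnchorLocalClause (n d : ℕ) (P : Motives.AbelianVariety ℂ) (h : complexBetti P.X 2)
    (w : complexBetti P.X (2 * n)) : Prop :=
  ∀ ⦃𝒳 S : Motives.SchemeOver ℂ⦄ (f : 𝒳 ⟶ S), Motives.IsSmoothProjectiveFamily f (2 * n) →
    IsQuasiProjectiveOver 𝒳 → IsQuasiProjectiveOver S → IrreducibleSpace S.left →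
    AlgebraicGeometry.Smooth S.hom →
    (∀ s : Motives.ComplexPoints S, ∃ (A'' : Motives.AbelianVariety ℂ) (φ'' : A'' ⟶ A''),
        A''.dim = 2 * n ∧ φ'' ≫ φ'' = -(d • 𝟙 A'') ∧ Nonempty (A''.X ≅ Motives.fiberOver f s)) →
    ∀ (H : complexBetti 𝒳 2) (W : complexBetti 𝒳 (2 * n)),
      (∀ s : Motives.ComplexPoints S,
        IsRationalClass (complexBetti.map (Motives.fiberι f s) 2 H) ∧
          IsOfHodgeType (2 * n) (Motives.fiberOver f s) 2 1 1 (complexBetti.map (Motives.fiberι f s) 2 H)) →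
      (∀ s : Motives.ComplexPoints S,
        IsRationalClass (complexBetti.map (Motives.fiberι f s) (2 * n) W) ∧
          IsOfHodgeType (2 * n) (Motives.fiberOver f s) (2 * n) n n
            (complexBetti.map (Motives.fiberι f s) (2 * n) W)) →
      ∀ (s₀ : Motives.ComplexPoints S) (e' : P.X ≅ Motives.fiberOver f s₀),
        complexBetti.map e'.hom 2 (complexBetti.map (Motives.fiberι f s₀) 2 H) = h →
        complexBetti.map e'.hom (2 * n) (complexBetti.map (Motives.fiberι f s₀) (2 * n) W) = w →
        ∃ (U : Set (Motives.ComplexPoints S)) (q : ℚ), IsOpen U ∧ s₀ ∈ U ∧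
          ∀ s ∈ U, ((q : ℚ) : ℂ) • cupPowTwo (complexBetti.map (Motives.fiberι f s) 2 H) n +
            complexBetti.map (Motives.fiberι f s) (2 * n) W ∈ algebraicClasses (Motives.fiberOver f s) n

/-- **A `√-d`-Weil family from the anchor `(P, h, w)` REACHES the target `(A, φ)`.** VERBATIM the `∃`-block
concluding `weilFamilyReach_hyperbolic`, with the anchor's polarization class abstracted to `h`: a smooth
projective family `f : 𝒳 ⟶ S` of abelian `2n`-folds with an endomorphism of square `-d`, closed in `ℙᴺ × S` over
a smooth irreducible quasi-projective `S`; a chart `e' : P.X ≅ 𝒳_{s₀}`; a global class `H`, rational `(1,1)` on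
every fibre, with `e'^*(H|_{s₀}) = h`; a CONTINUOUS fibrewise-`(n,n)` section `σ` of `R^{2n} f_*ℂ` with
`σ(s₀) = e'^{-1*} w`; and a fibre `𝒳_{s₁} ≅ A'` with `(A', φ')` `K`-ISOGENOUS to `(A, φ)` (`v ∘ u = [m]`, `u` flat,
`v` intertwining `φ'` and `φ`) on which `σ(s₁)` is a NON-ZERO class of `weilClassesOf A' φ' n d`. Between a
hyperbolic anchor and a hyperbolic target this is the content of Deligne's universal polarized family with reach
(`weilFamilyReaches_of_reach_hyperbolic`); for the other components (`det H ≢ (-1)ⁿ`) no rendering exists yet.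
[cite: Deligne1982HodgeCycles, proof of Thm. 4.8 (pp. 47–52)] [cite: vanGeemen1994HodgeAV, 5.2–5.4 and 5.8–5.11]
[cite: Landherr1936HermitianForms, Satz] -/
def WeilFamilyReaches (n d : ℕ) (P : Motives.AbelianVariety ℂ) (h : complexBetti P.X 2)
    (w : complexBetti P.X (2 * n)) (A : Motives.AbelianVariety ℂ) (φ : A ⟶ A) : Prop :=
  ∃ (𝒳 S : Motives.SchemeOver ℂ) (f : 𝒳 ⟶ S) (s₀ s₁ : Motives.ComplexPoints S)
    (e' : P.X ≅ Motives.fiberOver f s₀) (A' : Motives.AbelianVariety ℂ) (φ' : A' ⟶ A')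
    (e₁ : A'.X ≅ Motives.fiberOver f s₁) (σ : Motives.ComplexPoints S → FiberClass f (2 * n))
    (H : complexBetti 𝒳 2),
    Motives.IsSmoothProjectiveFamily f (2 * n) ∧
    (∃ (N : ℕ) (ι : 𝒳 ⟶ MonoidalCategoryStruct.tensorObj (Motives.projectiveSpace N ℂ) S),
      AlgebraicGeometry.IsClosedImmersion ι.left ∧
        ι ≫ CartesianMonoidalCategory.snd (Motives.projectiveSpace N ℂ) S = f) ∧
    IrreducibleSpace S.left ∧ AlgebraicGeometry.Smooth S.hom ∧ IsQuasiProjectiveOver S ∧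
    (∀ s : Motives.ComplexPoints S, ∃ (A'' : Motives.AbelianVariety ℂ) (φ'' : A'' ⟶ A''),
        A''.dim = 2 * n ∧ φ'' ≫ φ'' = -(d • 𝟙 A'') ∧ Nonempty (A''.X ≅ Motives.fiberOver f s)) ∧
    (∀ s : Motives.ComplexPoints S,
      IsRationalClass (complexBetti.map (Motives.fiberι f s) 2 H) ∧
        IsOfHodgeType (2 * n) (Motives.fiberOver f s) 2 1 1 (complexBetti.map (Motives.fiberι f s) 2 H)) ∧
    complexBetti.map e'.hom 2 (complexBetti.map (Motives.fiberι f s₀) 2 H) = h ∧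
    Continuous σ ∧ (∀ s, (σ s).pt = s) ∧
    (∀ s, IsOfHodgeType (2 * n) (Motives.fiberOver f (σ s).pt) (2 * n) n n (σ s).cls) ∧
    σ s₀ = ⟨s₀, complexBetti.map e'.inv (2 * n) w⟩ ∧
    A'.dim = 2 * n ∧ φ' ≫ φ' = -(d • 𝟙 A') ∧
    (∃ (u : A ⟶ A') (v : A' ⟶ A) (m : ℕ), 0 < m ∧ u ≫ v = m • 𝟙 A ∧
      AlgebraicGeometry.Flat u.hom.hom.hom.left ∧ v ≫ φ = φ' ≫ v) ∧
    ∃ w₁ : complexBetti (Motives.fiberOver f s₁) (2 * n),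
      σ s₁ = ⟨s₁, w₁⟩ ∧ complexBetti.map e₁.hom (2 * n) w₁ ∈ weilClassesOf A' φ' n d ∧
        complexBetti.map e₁.hom (2 * n) w₁ ≠ 0

/-- **`(A, φ)` is REACHED by a `√-d`-Weil family from some locally algebraic anchor**: there are anchor data
`(P, h, w)` with `w` rational, the local clause at `(P, h, w)`, and a family from `(P, h, w)` reaching `(A, φ)`.
δ-free by construction: the component invariant `det H ∈ ℚˣ/N(Kˣ)` of the target (Landherr; van Geemen 5.2 (3))
is hidden in the existential. An engine-input predicate (module docstring), defined here, asserted nowhere.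
[cite: vanGeemen1994HodgeAV, 5.2–5.4] [cite: Landherr1936HermitianForms, Satz] -/
def WeilReachedFromLocalAnchor (n d : ℕ) (A : Motives.AbelianVariety ℂ) (φ : A ⟶ A) : Prop :=
  ∃ (P : Motives.AbelianVariety ℂ) (h : complexBetti P.X 2) (w : complexBetti P.X (2 * n)),
    IsRationalClass w ∧ WeilAnchorLocalClause n d P h w ∧ WeilFamilyReaches n d P h w A φ

/-- `HasLocallyAlgebraicWeilAnchor n d` IS "a hyperbolic anchor `(P, ψ₀, e, a)` with a non-zero rational Weil
class `w` satisfying `WeilAnchorLocalClause n d P h_K w`" — definitionally (`Iff.rfl`).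
[cite: Markman2025SecantWeil, §1.5] -/
theorem hasLocallyAlgebraicWeilAnchor_iff (n d : ℕ) :
    HasLocallyAlgebraicWeilAnchor n d ↔
      ∃ (P : Motives.AbelianVariety ℂ) (ψ₀ : P ⟶ P) (e : Motives.ProjectiveEmbedding P.X)
        (a : complexBetti (Motives.projectiveSpace e.n ℂ) 2) (w : complexBetti P.X (2 * n)),
        P.dim = 2 * n ∧ ψ₀ ≫ ψ₀ = -(d • 𝟙 P) ∧ IsRationalClass a ∧ a ≠ 0 ∧
        Motives.IsHyperbolicWeilType P ψ₀ n
          ((d : ℂ) • complexBetti.map e.ι 2 a + complexBetti.map ψ₀.hom.hom.hom 2 (complexBetti.map e.ι 2 a)) ∧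
        w ∈ weilClassesOf P ψ₀ n d ∧ IsRationalClass w ∧ w ≠ 0 ∧
        WeilAnchorLocalClause n d P
          ((d : ℂ) • complexBetti.map e.ι 2 a + complexBetti.map ψ₀.hom.hom.hom 2 (complexBetti.map e.ι 2 a)) w :=
  Iff.rfl

/-- The named fact `weilFamilyReach_hyperbolic` supplies `WeilFamilyReaches` from a hyperbolic anchor (with a
non-zero Weil class `w`) to every hyperbolic target of the same `(n, d)` — direct application, fact BY NAME.
[cite: Deligne1982HodgeCycles, proof of Thm. 4.8] [cite: vanGeemen1994HodgeAV, 5.2–5.11] -/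
theorem weilFamilyReaches_of_reach_hyperbolic (hF : weilFamilyReach_hyperbolic) (n d : ℕ) (hn : 1 ≤ n)
    (hd : 1 ≤ d) (P : Motives.AbelianVariety ℂ) (ψ₀ : P ⟶ P) (e : Motives.ProjectiveEmbedding P.X)
    (a : complexBetti (Motives.projectiveSpace e.n ℂ) 2) (hP : P.dim = 2 * n) (hψ : ψ₀ ≫ ψ₀ = -(d • 𝟙 P))
    (ha : IsRationalClass a) (ha0 : a ≠ 0)
    (hhyp : Motives.IsHyperbolicWeilType P ψ₀ n
      ((d : ℂ) • complexBetti.map e.ι 2 a + complexBetti.map ψ₀.hom.hom.hom 2 (complexBetti.map e.ι 2 a)))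
    (w : complexBetti P.X (2 * n)) (hwW : w ∈ weilClassesOf P ψ₀ n d) (hw0 : w ≠ 0)
    (A : Motives.AbelianVariety ℂ) (φ : A ⟶ A) (eA : Motives.ProjectiveEmbedding A.X)
    (aA : complexBetti (Motives.projectiveSpace eA.n ℂ) 2) (hA : A.dim = 2 * n) (hφ : φ ≫ φ = -(d • 𝟙 A))
    (haA : IsRationalClass aA) (haA0 : aA ≠ 0)
    (hhypA : Motives.IsHyperbolicWeilType A φ n
      ((d : ℂ) • complexBetti.map eA.ι 2 aA + complexBetti.map φ.hom.hom.hom 2 (complexBetti.map eA.ι 2 aA))) :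
    WeilFamilyReaches n d P
      ((d : ℂ) • complexBetti.map e.ι 2 a + complexBetti.map ψ₀.hom.hom.hom 2 (complexBetti.map e.ι 2 a))
      w A φ :=
  hF n d hn hd P ψ₀ e a hP hψ ha ha0 hhyp w hwW hw0 A φ eA aA hA hφ haA haA0 hhypA

/-- On HYPERBOLIC targets the δ-free node follows from the gen-3 inputs: a locally algebraic hyperbolic anchor
(`HasLocallyAlgebraicWeilAnchor n d`) ∧ Deligne's hyperbolic reach (`weilFamilyReach_hyperbolic`) ⟹
`WeilReachedFromLocalAnchor n d A φ`. [cite: Deligne1982HodgeCycles, proof of Thm. 4.8]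
[cite: Markman2025SecantWeil, §1.5] -/
theorem weilReachedFromLocalAnchor_of_localAnchor_of_reach_hyperbolic (n d : ℕ) (hn : 1 ≤ n) (hd : 1 ≤ d)
    (hL : HasLocallyAlgebraicWeilAnchor n d) (hF : weilFamilyReach_hyperbolic)
    (A : Motives.AbelianVariety ℂ) (φ : A ⟶ A) (eA : Motives.ProjectiveEmbedding A.X)
    (aA : complexBetti (Motives.projectiveSpace eA.n ℂ) 2) (hA : A.dim = 2 * n) (hφ : φ ≫ φ = -(d • 𝟙 A))
    (haA : IsRationalClass aA) (haA0 : aA ≠ 0)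
    (hhypA : Motives.IsHyperbolicWeilType A φ n
      ((d : ℂ) • complexBetti.map eA.ι 2 aA + complexBetti.map φ.hom.hom.hom 2 (complexBetti.map eA.ι 2 aA))) :
    WeilReachedFromLocalAnchor n d A φ := by
  obtain ⟨P, ψ, e, a, w, hP8, hψ, ha, ha0, hhyp, hwW, hwrat, hw0, hloc⟩ := hL
  exact ⟨P, _, w, hwrat, hloc, weilFamilyReaches_of_reach_hyperbolic hF n d hn hd P ψ e a hP8 hψ ha ha0 hhyp w
    hwW hw0 A φ eA aA hA hφ haA haA0 hhypA⟩

end HodgeTheory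

end Literature.AlgebraicGeometry.HodgeTheory

end
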